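import Summits.KontsevichZagierPeriods.KontsevichZagierPeriods.Theses.HeckeMultiplicityOne
import Summits.KontsevichZagierPeriods.KontsevichZagierPeriods.Theorems.HermiteRigidityGenusTwoCycleTransferPushforwardDimOne
import Summits.KontsevichZagierPeriods.KontsevichZagierPeriods.Theorems.HeckeMultiplicityOneTorsionTiling11a1Doubling
import Literature.NumberTheory.Transcendental.KZDominatedFamilyRelations
import Literature.NumberTheory.Transcendental.KZCalculusProofs

/-!
# `TorsionTiling11a1` (item stmt-KontsevichZagierPeriods-4692, route HeckeMultiplicityOne)

For `E = X₀(11) = 11a1`, `q(x) = 4x³ − 4x² − 40x − 79 = (2y + 1)²`, the two Kontsevich–Zagier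
integral representations `r = [(16, ∞), 1/√q]` (`= Ω_E/5`: the arc of `E(ℝ) ≅ ℝ/Ω_Eℤ` from `O` to
the `5`-torsion point `(16, 60)`) and `r' = [{q > 0}, 1/√q]` (`= Ω_E/2`) satisfy
`5·[r] − 2·[r'] ∈ KZ.relations` — the rules form of `L(E,1)/Ω_E = 1/5`.

Rules proof (all moves inside `KZ.relations`). Write `{q > 0} = D₁ ∪ D₂ ∪ D₃` up to the null
set `{5, 16}`, `D₁ = (16, ∞)`, `D₂ = (5, 16)`, `D₃ = {q > 0} ∩ (−∞, 5)`, and `Iⱼ = [Dⱼ, 1/√q]`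
(rule 1a: `[r'] ≡ [I₁] + [I₂] + [I₃]`, `[r] ≡ [I₁]`). Instead of the translation by the
`5`-torsion point (whose `x`-map involves `√q`) we use the DUPLICATION `x`-map
`φ = N/q`, `N = x⁴ + 20x² + 158x + 21`, a rational function over `ℚ` with `[2]^*ω = 2ω`
(`HeckeMultiplicityOneTorsionTiling11a1Doubling.lean`): on `E(ℝ) ≅ ℝ/Ωℤ` doubling maps the arc
`(0, Ω/5)` over `D₁` onto the arc `(0, 2Ω/5)` over `(5, ∞)`, and the arc `(2Ω/5, Ω/2)` over `D₃`
onto the arc `(4Ω/5, Ω) ≅ (0, Ω/5)` over `D₁`. As moves of rule (2) with Jacobian weight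
`|φ′|/√(q∘φ) = 2/√q`: `[D₁, 2/√q] ∼ [(5, ∞), 1/√q] ≡ [I₁] + [I₂]` and `[D₃, 2/√q] ∼ [I₁]`;
with rule (1b) (`[D, 2/√q] ≡ 2[D, 1/√q]`) this gives `[I₂] ≡ [I₁]`, `2[I₃] ≡ [I₁]`, whence
`5[r] − 2[r'] ≡ 3[I₁] − 2[I₂] − 2[I₃] ≡ 0`.

`TorsionTiling11a1_proof` concludes the route declaration
`Summit.KontsevichZagierPeriods.KontsevichZagierPeriods.Theses.HeckeMultiplicityOne.TorsionTiling11a1`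
by name.

References: M. Kontsevich, D. Zagier, *Periods* (2001), §1.2; J. E. Cremona, *Algorithms for
Modular Elliptic Curves* (1997), Table 1 (11a1: `E(ℚ) ≅ ℤ/5`, `Ω = 1.26920930…`);
J. H. Silverman, *The Arithmetic of Elliptic Curves* (2009), III.2.3 (duplication formula).
-/

noncomputable section

open Set MeasureTheory MvPolynomial
open Literature.NumberTheory.Transcendental Literature.ModelTheory.ExponentialFields
open Summit.KontsevichZagierPeriods.HermiteRigidity.GenusTwoCycleTransfer
  (det_smul_id_fin_one hasFDerivAt_fin_one)

namespace Summit.KontsevichZagierPeriods.HeckeMultiplicityOne.TorsionTiling11a1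

/-! ### One-dimensional bookkeeping -/

/-- A vector of `ℝ¹` is the constant vector on its `0`-th coordinate. [folklore] -/
theorem const_apply_zero (p : Fin 1 → ℝ) : (fun _ : Fin 1 => p 0) = p := by
  funext i
  rw [Fin.fin_one_eq_zero i]

/-- Images under the lift `p ↦ (φ (p 0))` to `ℝ¹` of a real map `φ`. [folklore] -/
theorem image_lift (φ : ℝ → ℝ) (S : Set ℝ) :
    (fun p : Fin 1 → ℝ => fun _ : Fin 1 => φ (p 0)) '' {p | p 0 ∈ S} = {p | p 0 ∈ φ '' S} := by
  ext X
  simp only [mem_image, mem_setOf_eq]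
  constructor
  · rintro ⟨p, hp, rfl⟩
    exact ⟨p 0, hp, rfl⟩
  · rintro ⟨y, hy, hyX⟩
    refine ⟨fun _ => y, hy, ?_⟩
    rw [← const_apply_zero X]
    funext i
    exact hyX

/-- A coordinate hyperplane `{w 0 = c}` of `ℝ¹` is Lebesgue-null. [folklore] -/
theorem volume_setOf_apply_zero_eq (c : ℝ) : volume {w : Fin 1 → ℝ | w 0 = c} = 0 := by
  rw [volume_pi]
  exact Measure.pi_hyperplane _ _ _

/-- Right half-lines `{a < x}` with rational endpoint are `ℚ`-semialgebraic in `ℝ¹`. [folklore] -/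
theorem isSemialgebraic_const_lt (a : ℚ) : IsSemialgebraic ℚ {p : Fin 1 → ℝ | (a : ℝ) < p 0} := by
  have h := isSemialgebraic_setOf_eval_lt (k := ℚ) (R := ℝ) (C a : MvPolynomial (Fin 1) ℚ) (X 0)
  have hset : {p : Fin 1 → ℝ | (a : ℝ) < p 0} =
      {x | aeval x (C a : MvPolynomial (Fin 1) ℚ) < aeval x (X 0 : MvPolynomial (Fin 1) ℚ)} := by
    ext x
    simp
  rw [hset]
  exact h

/-- Left half-lines `{x < a}` with rational endpoint are `ℚ`-semialgebraic in `ℝ¹`. [folklore] -/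
theorem isSemialgebraic_lt_const (a : ℚ) : IsSemialgebraic ℚ {p : Fin 1 → ℝ | p 0 < (a : ℝ)} := by
  have h := isSemialgebraic_setOf_eval_lt (k := ℚ) (R := ℝ) (X 0 : MvPolynomial (Fin 1) ℚ) (C a)
  have hset : {p : Fin 1 → ℝ | p 0 < (a : ℝ)} =
      {x | aeval x (X 0 : MvPolynomial (Fin 1) ℚ) < aeval x (C a : MvPolynomial (Fin 1) ℚ)} := by
    ext x
    simp
  rw [hset]
  exact h

/-- **One real change of variables is one move of rule (2).** If `φ` is `ℚ`-semialgebraic on the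
domain of `ρ : KZ.IntegralRep 1` (in the coordinate `p 0`), differentiable there with derivative
`φ'`, injective there, `ρ'.domain` is the image, and `ρ.integrand p = ρ'.integrand (φ p)·|φ′(p 0)|`,
then `[ρ] − [ρ'] ∈ KZ.relations` (`Φ = (φ (p 0))`, `Φ′ = φ′(p 0) • id`, `det Φ′ = φ′(p 0)`).
[cite: KontsevichZagier2001, §1.2 rule (2)] -/
theorem of_sub_of_mem_relations_of_hasDerivAt {ρ ρ' : KZ.IntegralRep 1} (φ φ' : ℝ → ℝ)
    (hsa : IsSemialgebraicFunOn ℚ ρ.domain (fun p => φ (p 0)))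
    (hder : ∀ p ∈ ρ.domain, HasDerivAt φ (φ' (p 0)) (p 0))
    (hinj : ∀ p ∈ ρ.domain, ∀ p' ∈ ρ.domain, φ (p 0) = φ (p' 0) → p 0 = p' 0)
    (hd : ρ'.domain = (fun p : Fin 1 → ℝ => fun _ : Fin 1 => φ (p 0)) '' ρ.domain)
    (hi : ∀ p ∈ ρ.domain, ρ.integrand p = ρ'.integrand (fun _ => φ (p 0)) * |φ' (p 0)|) :
    KZ.of ρ - KZ.of ρ' ∈ KZ.relations := by
  refine KZ.changeOfVariablesRel_subset_relations
    ⟨1, ρ, ρ', fun p _ => φ (p 0), fun p => φ' (p 0) • ContinuousLinearMap.id ℝ (Fin 1 → ℝ),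
      IsSemialgebraicMapOn.of_forall ρ.isSemialgebraic_domain fun _ => hsa,
      fun p hp => (hasFDerivAt_fin_one φ (φ' (p 0)) p (hder p hp)).hasFDerivWithinAt,
      fun p hp p' hp' h => ?_, hd, fun p hp => ?_, rfl⟩
  · have h0 : φ (p 0) = φ (p' 0) := congrFun h 0
    rw [← const_apply_zero p, ← const_apply_zero p', hinj p hp p' hp' h0]
  · rw [det_smul_id_fin_one]
    exact hi p hp

/-! ### The route declaration -/

/-- **`TorsionTiling11a1`** (item stmt-KontsevichZagierPeriods-4692 of route HeckeMultiplicityOne):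
for `q = 4x³ − 4x² − 40x − 79` (curve `11a1`) and any KZ integral representations
`r = [(16, ∞), 1/√q]`, `r' = [{q > 0}, 1/√q]`: `5·[r] − 2·[r'] ∈ KZ.relations`
(`∫_{16}^∞ dx/√q = Ω_E/5`, i.e. `L(E,1)/Ω_E = 1/5`, inside the rules), by the duplication `x`-map
run as two moves of rule (2) plus domain/integrand additivity.
[cite: KontsevichZagier2001, §1.2] [cite: Cremona1997, Table 1] -/
theorem TorsionTiling11a1_proof :
    Summit.KontsevichZagierPeriods.KontsevichZagierPeriods.Theses.HeckeMultiplicityOne.TorsionTiling11a1 := by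
  unfold Summit.KontsevichZagierPeriods.KontsevichZagierPeriods.Theses.HeckeMultiplicityOne.TorsionTiling11a1
  intro r r' hrd hri hρd hρi
  -- the polynomials of the duplication map
  set q : ℝ → ℝ := fun t => 4 * t ^ 3 - 4 * t ^ 2 - 40 * t - 79 with hq_def
  set N : ℝ → ℝ := fun t => t ^ 4 + 20 * t ^ 2 + 158 * t + 21 with hN_def
  set W : ℝ → ℝ := fun t => 4 * t ^ 6 - 8 * t ^ 5 - 200 * t ^ 4 - 1580 * t ^ 3 - 420 * t ^ 2
    - 2992 * t - 11642 with hW_def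
  set φ : ℝ → ℝ := fun y => N y / q y with hφ_def
  have hq : ∀ t, q t = 4 * t ^ 3 - 4 * t ^ 2 - 40 * t - 79 := fun t => rfl
  have hN : ∀ t, N t = t ^ 4 + 20 * t ^ 2 + 158 * t + 21 := fun t => rfl
  have hW : ∀ t, W t = 4 * t ^ 6 - 8 * t ^ 5 - 200 * t ^ 4 - 1580 * t ^ 3 - 420 * t ^ 2
      - 2992 * t - 11642 := fun t => rfl
  -- the cells
  set D₁ : Set (Fin 1 → ℝ) := {x | 16 < x 0} with hD₁
  set D₅ : Set (Fin 1 → ℝ) := {x | 5 < x 0} with hD₅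
  set D₂ : Set (Fin 1 → ℝ) := D₅ ∩ {x | x 0 < 16} with hD₂
  set D₃ : Set (Fin 1 → ℝ) := {x | 0 < 4 * x 0 ^ 3 - 4 * x 0 ^ 2 - 40 * x 0 - 79} ∩ {x | x 0 < 5}
    with hD₃
  have hS1 : IsSemialgebraic ℚ D₁ := hrd ▸ r.isSemialgebraic_domain
  have hSq : IsSemialgebraic ℚ {x : Fin 1 → ℝ | 0 < 4 * x 0 ^ 3 - 4 * x 0 ^ 2 - 40 * x 0 - 79} :=
    hρd ▸ r'.isSemialgebraic_domain
  have hS5 : IsSemialgebraic ℚ D₅ := by simpa using isSemialgebraic_const_lt 5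
  have hS2 : IsSemialgebraic ℚ D₂ := hS5.inter (by simpa using isSemialgebraic_lt_const 16)
  have hS3 : IsSemialgebraic ℚ D₃ := hSq.inter (by simpa using isSemialgebraic_lt_const 5)
  have h1sub : D₁ ⊆ r'.domain := fun x hx => by
    rw [hρd]; exact q_pos_of_five_lt (lt_trans (by norm_num) hx)
  have h5sub : D₅ ⊆ r'.domain := fun x hx => by rw [hρd]; exact q_pos_of_five_lt hx
  have h2sub : D₂ ⊆ r'.domain := fun x hx => h5sub hx.1
  have h3sub : D₃ ⊆ r'.domain := fun x hx => by rw [hρd]; exact hx.1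
  -- the pieces `Iⱼ = [Dⱼ, 1/√q]`, `K = [(5,∞), 1/√q]`
  set I₁ := r'.restrict D₁ hS1 h1sub with hI₁
  set I₂ := r'.restrict D₂ hS2 h2sub with hI₂
  set I₃ := r'.restrict D₃ hS3 h3sub with hI₃
  set K := r'.restrict D₅ hS5 h5sub with hK
  -- `[r] ≡ [I₁]` (same domain, same integrand on it)
  have e0 : KZ.of r - KZ.of I₁ ∈ KZ.relations := by
    refine KZ.of_sub_of_mem_relations_of_eqOn (by rw [hrd]; rfl) fun x hx => ?_
    have hx1 : x ∈ D₁ := by rw [hrd] at hx; exact hx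
    exact (hri hx).trans (hρi (h1sub hx1)).symm
  -- `[r'] ≡ [I₁] + [I₂] + [I₃]` (rule 1a; the complement `{5, 16}` is null)
  have hVsa : IsSemialgebraic ℚ (D₂ ∪ D₃) := hS2.union hS3
  have hVsub : D₂ ∪ D₃ ⊆ r'.domain := union_subset h2sub h3sub
  have hUsa : IsSemialgebraic ℚ (D₁ ∪ (D₂ ∪ D₃)) := hS1.union hVsa
  have hUsub : D₁ ∪ (D₂ ∪ D₃) ⊆ r'.domain := union_subset h1sub hVsub
  have e1a : KZ.of r' - KZ.of (r'.restrict _ hUsa hUsub) ∈ KZ.relations := by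
    refine r'.of_sub_of_restrict_mem_relations hUsa hUsub (measure_mono_null (fun x hx => ?_)
      (measure_union_null (volume_setOf_apply_zero_eq 16) (volume_setOf_apply_zero_eq 5)))
    rw [hρd] at hx
    obtain ⟨hqx, hnot⟩ := hx
    have hqx' : 0 < 4 * x 0 ^ 3 - 4 * x 0 ^ 2 - 40 * x 0 - 79 := hqx
    have hx1 : ¬ (16 < x 0) := fun h => hnot (Or.inl h)
    have hx2 : ¬ (5 < x 0 ∧ x 0 < 16) := fun h => hnot (Or.inr (Or.inl h))
    have hx3 : ¬ (0 < 4 * x 0 ^ 3 - 4 * x 0 ^ 2 - 40 * x 0 - 79 ∧ x 0 < 5) := fun h =>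
      hnot (Or.inr (Or.inr h))
    show x 0 = 16 ∨ x 0 = 5
    rcases lt_trichotomy (x 0) 5 with h | h | h
    · exact absurd ⟨hqx', h⟩ hx3
    · exact Or.inr h
    · rcases lt_trichotomy (x 0) 16 with h' | h' | h'
      · exact absurd ⟨h, h'⟩ hx2
      · exact Or.inl h'
      · exact absurd h' hx1
  have e1b : KZ.of (r'.restrict _ hUsa hUsub) - KZ.of I₁ - KZ.of (r'.restrict _ hVsa hVsub) ∈
      KZ.relations := by
    refine KZ.domainAddRel_subset_relations ⟨1, r'.restrict _ hUsa hUsub, I₁,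
      r'.restrict _ hVsa hVsub, rfl, ?_, fun _ _ => rfl, fun _ _ => rfl, rfl⟩
    rw [show I₁.domain ∩ (r'.restrict _ hVsa hVsub).domain = ∅ from
      eq_empty_of_forall_notMem fun x hx => ?_, measure_empty]
    have h16 : 16 < x 0 := hx.1
    rcases hx.2 with h | h
    · have : x 0 < 16 := h.2
      linarith
    · have : x 0 < 5 := h.2
      linarith
  have e1c : KZ.of (r'.restrict _ hVsa hVsub) - KZ.of I₂ - KZ.of I₃ ∈ KZ.relations := by
    refine KZ.domainAddRel_subset_relations ⟨1, r'.restrict _ hVsa hVsub, I₂, I₃, rfl, ?_,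
      fun _ _ => rfl, fun _ _ => rfl, rfl⟩
    rw [show I₂.domain ∩ I₃.domain = ∅ from eq_empty_of_forall_notMem fun x hx => ?_,
      measure_empty]
    have h5 : 5 < x 0 := hx.1.1
    have h5' : x 0 < 5 := hx.2.2
    linarith
  -- `[K] ≡ [I₁] + [I₂]` (rule 1a; the complement `{16}` is null)
  have hEsa : IsSemialgebraic ℚ (D₁ ∪ D₂) := hS1.union hS2
  have hEsub : D₁ ∪ D₂ ⊆ K.domain := union_subset
    (fun x hx => show (5:ℝ) < x 0 from lt_trans (by norm_num : (5:ℝ) < 16) hx) fun x hx => hx.1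
  have e4a : KZ.of K - KZ.of (K.restrict _ hEsa hEsub) ∈ KZ.relations := by
    refine K.of_sub_of_restrict_mem_relations hEsa hEsub (measure_mono_null (fun x hx => ?_)
      (volume_setOf_apply_zero_eq 16))
    obtain ⟨h5x, hnot⟩ := hx
    have h5x' : 5 < x 0 := h5x
    have hx1 : ¬ (16 < x 0) := fun h => hnot (Or.inl h)
    have hx2 : ¬ (5 < x 0 ∧ x 0 < 16) := fun h => hnot (Or.inr h)
    show x 0 = 16
    rcases lt_trichotomy (x 0) 16 with h' | h' | h'
    · exact absurd ⟨h5x', h'⟩ hx2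
    · exact h'
    · exact absurd h' hx1
  have e4b : KZ.of (K.restrict _ hEsa hEsub) - KZ.of I₁ - KZ.of I₂ ∈ KZ.relations := by
    refine KZ.domainAddRel_subset_relations ⟨1, K.restrict _ hEsa hEsub, I₁, I₂, rfl, ?_,
      fun _ _ => rfl, fun _ _ => rfl, rfl⟩
    rw [show I₁.domain ∩ I₂.domain = ∅ from eq_empty_of_forall_notMem fun x hx => ?_,
      measure_empty]
    have h16 : 16 < x 0 := hx.1
    have h16' : x 0 < 16 := hx.2.2
    linarith
  -- the doubled pieces `J₁ = [D₁, 2/√q]`, `J₃ = [D₃, 2/√q]` and rule 1b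
  obtain ⟨J₁, hJ₁d, hJ₁i⟩ : ∃ J : KZ.IntegralRep 1, J.domain = D₁ ∧
      J.integrand = fun x => 2 * r'.integrand x := by
    refine ⟨⟨D₁, _, hS1, ?_, (r'.integrableOn.mono_set h1sub).const_mul 2⟩, rfl, rfl⟩
    exact (IsSemialgebraicFunOn.mul_holds (isSemialgebraicFunOn_natCast hS1 2)
      (r'.isSemialgebraicFunOn_integrand.mono h1sub hS1)).congr fun x _ => by simp
  obtain ⟨J₃, hJ₃d, hJ₃i⟩ : ∃ J : KZ.IntegralRep 1, J.domain = D₃ ∧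
      J.integrand = fun x => 2 * r'.integrand x := by
    refine ⟨⟨D₃, _, hS3, ?_, (r'.integrableOn.mono_set h3sub).const_mul 2⟩, rfl, rfl⟩
    exact (IsSemialgebraicFunOn.mul_holds (isSemialgebraicFunOn_natCast hS3 2)
      (r'.isSemialgebraicFunOn_integrand.mono h3sub hS3)).congr fun x _ => by simp
  have e2 : KZ.of J₁ - KZ.of I₁ - KZ.of I₁ ∈ KZ.relations := by
    refine KZ.integrandAddRel_subset_relations ⟨1, J₁, I₁, I₁, by rw [hJ₁d]; rfl,
      by rw [hJ₁d]; rfl, fun x _ => ?_, rfl⟩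
    rw [hJ₁i]
    show 2 * r'.integrand x = r'.integrand x + r'.integrand x
    ring
  have e5 : KZ.of J₃ - KZ.of I₃ - KZ.of I₃ ∈ KZ.relations := by
    refine KZ.integrandAddRel_subset_relations ⟨1, J₃, I₃, I₃, by rw [hJ₃d]; rfl,
      by rw [hJ₃d]; rfl, fun x _ => ?_, rfl⟩
    rw [hJ₃i]
    show 2 * r'.integrand x = r'.integrand x + r'.integrand x
    ring
  -- the duplication map is `ℚ`-semialgebraic wherever `q ≠ 0`
  have hφsa : ∀ (D : Set (Fin 1 → ℝ)), IsSemialgebraic ℚ D → (∀ p ∈ D, q (p 0) ≠ 0) →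
      IsSemialgebraicFunOn ℚ D (fun p => φ (p 0)) := by
    intro D hD hq0
    have h := isSemialgebraicFunOn_aeval_div_aeval hD
      (X 0 ^ 4 + 20 * X 0 ^ 2 + 158 * X 0 + 21 : MvPolynomial (Fin 1) ℚ)
      (4 * X 0 ^ 3 - 4 * X 0 ^ 2 - 40 * X 0 - 79 : MvPolynomial (Fin 1) ℚ)
      (fun p hp => by simpa [hq_def] using hq0 p hp)
    refine h.congr fun p _ => ?_
    simp only [map_add, map_sub, map_mul, map_pow, MvPolynomial.aeval_X, map_ofNat]
    rfl
  -- rule 2, first move: `[D₁, 2/√q] ∼ [(5, ∞), 1/√q]` along `φ`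
  have e3 : KZ.of J₁ - KZ.of K ∈ KZ.relations := by
    refine of_sub_of_mem_relations_of_hasDerivAt φ (fun t => W t / q t ^ 2) ?_ ?_ ?_ ?_ ?_
    · rw [hJ₁d]
      exact hφsa D₁ hS1 fun p hp => (q_pos_of_five_lt (lt_trans (by norm_num) hp)).ne'
    · intro p hp
      rw [hJ₁d] at hp
      exact hasDerivAt_phi hN hq hW (q_pos_of_five_lt (lt_trans (by norm_num) hp)).ne'
    · intro p hp p' hp' h
      rw [hJ₁d] at hp hp'
      exact (strictMonoOn_phi hN hq).injOn hp hp' h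
    · rw [hJ₁d, show D₁ = {p : Fin 1 → ℝ | p 0 ∈ Ioi 16} from rfl, image_lift,
        image_phi_Ioi hN hq]
      rfl
    · intro p hp
      rw [hJ₁d] at hp
      have h16 : 16 < p 0 := hp
      have hqp : 0 < q (p 0) := q_pos_of_five_lt (by linarith)
      have h5 : 5 < φ (p 0) := five_lt_phi hN hq h16
      have hqφ : 0 < q (φ (p 0)) := q_pos_of_five_lt h5
      have hφp : (fun _ : Fin 1 => φ (p 0)) ∈ r'.domain := h5sub h5
      rw [hJ₁i]
      show 2 * r'.integrand p = r'.integrand (fun _ => φ (p 0)) * |W (p 0) / q (p 0) ^ 2|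
      rw [hρi (h1sub hp), hρi hφp]
      show 2 * (1 / Real.sqrt (q (p 0))) = 1 / Real.sqrt (q (φ (p 0))) * |W (p 0) / q (p 0) ^ 2|
      rw [mul_one_div]
      exact jacobian_phi hN hq hW hqp hqφ
  -- rule 2, second move: `[D₃, 2/√q] ∼ [D₁, 1/√q]` along `φ`
  have e6 : KZ.of J₃ - KZ.of I₁ ∈ KZ.relations := by
    refine of_sub_of_mem_relations_of_hasDerivAt φ (fun t => W t / q t ^ 2) ?_ ?_ ?_ ?_ ?_
    · rw [hJ₃d]
      exact hφsa D₃ hS3 fun p hp => ne_of_gt hp.1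
    · intro p hp
      rw [hJ₃d] at hp
      exact hasDerivAt_phi hN hq hW (ne_of_gt hp.1)
    · intro p hp p' hp' h
      rw [hJ₃d] at hp hp'
      exact (strictAntiOn_phi hN hq).injOn hp hp' h
    · rw [hJ₃d, show D₃ = {p : Fin 1 → ℝ | p 0 ∈ {t : ℝ | 0 < q t ∧ t < 5}} from rfl, image_lift,
        image_phi_cell hN hq]
      rfl
    · intro p hp
      rw [hJ₃d] at hp
      have hqp : 0 < q (p 0) := hp.1
      have h16 : 16 < φ (p 0) := sixteen_lt_phi hN hq hqp hp.2
      have hqφ : 0 < q (φ (p 0)) := q_pos_of_five_lt (by linarith)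
      have hφp : (fun _ : Fin 1 => φ (p 0)) ∈ D₁ := h16
      rw [hJ₃i]
      show 2 * r'.integrand p = r'.integrand (fun _ => φ (p 0)) * |W (p 0) / q (p 0) ^ 2|
      rw [hρi (h3sub hp), hρi (h1sub hφp)]
      show 2 * (1 / Real.sqrt (q (p 0))) = 1 / Real.sqrt (q (φ (p 0))) * |W (p 0) / q (p 0) ^ 2|
      rw [mul_one_div]
      exact jacobian_phi hN hq hW hqp hqφ
  -- assembling: `5[r] − 2[r'] ≡ 3[I₁] − 2[I₂] − 2[I₃] ≡ 0`
  have key : (5 : ℤ) • KZ.of r - (2 : ℤ) • KZ.of r' =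
      (5 : ℤ) • (KZ.of r - KZ.of I₁) - (2 : ℤ) • (KZ.of r' - KZ.of (r'.restrict _ hUsa hUsub))
      - (2 : ℤ) • (KZ.of (r'.restrict _ hUsa hUsub) - KZ.of I₁ - KZ.of (r'.restrict _ hVsa hVsub))
      - (2 : ℤ) • (KZ.of (r'.restrict _ hVsa hVsub) - KZ.of I₂ - KZ.of I₃)
      - (2 : ℤ) • (KZ.of J₁ - KZ.of I₁ - KZ.of I₁) + (2 : ℤ) • (KZ.of J₁ - KZ.of K)
      + (2 : ℤ) • (KZ.of K - KZ.of (K.restrict _ hEsa hEsub))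
      + (2 : ℤ) • (KZ.of (K.restrict _ hEsa hEsub) - KZ.of I₁ - KZ.of I₂)
      + (KZ.of J₃ - KZ.of I₃ - KZ.of I₃) - (KZ.of J₃ - KZ.of I₁) := by
    abel
  rw [key]
  refine KZ.relations.sub_mem (KZ.relations.add_mem (KZ.relations.add_mem (KZ.relations.add_mem
    (KZ.relations.add_mem (KZ.relations.sub_mem (KZ.relations.sub_mem (KZ.relations.sub_mem
    (KZ.relations.sub_mem (KZ.relations.zsmul_mem e0 5) (KZ.relations.zsmul_mem e1a 2))
    (KZ.relations.zsmul_mem e1b 2)) (KZ.relations.zsmul_mem e1c 2)) (KZ.relations.zsmul_mem e2 2))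
    (KZ.relations.zsmul_mem e3 2)) (KZ.relations.zsmul_mem e4a 2)) (KZ.relations.zsmul_mem e4b 2))
    e5) e6

end Summit.KontsevichZagierPeriods.HeckeMultiplicityOne.TorsionTiling11a1

end
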